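import Literature.NumberTheory.Transcendental.KaehlerHodgeConjCounterexample
import Literature.NumberTheory.Transcendental.KaehlerHodgeDolbeaultHarmonicCounterexample
import Literature.NumberTheory.Transcendental.DolbeaultProofs
import Literature.NumberTheory.Transcendental.KaehlerHodgeTypeProofs
import Mathlib.Analysis.SpecialFunctions.Complex.Circle
import HarnessLib

/-!
# The named fact `existsUnique_isDolbeaultHarmonic_mk_eq` is false as stated
# (the `{id, (z, w) ↦ (z, w̄)}`-rigged `4`-torus, bidegree `(2,2)`)

Theorems-only companion (plus the definitions of one explicit model) of
`Literature/NumberTheory/Transcendental/KaehlerHodge.lean` (C12), written by the prove-seat of the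
named fact `existsUnique_isDolbeaultHarmonic_mk_eq` (D-0026 provefact unit, 2026-08-15). No named
fact is introduced.

`KaehlerHodge.lean` records the **Hodge theorem for `∂̄`** — C. Voisin, *Hodge Theory and Complex
Algebraic Geometry I* (2002), §5.3.1, Thm. 5.24, p. 129 ("Let `E` be a Hermitian holomorphic vector
bundle over a complex compact manifold `X` equipped with a Hermitian metric. Then … the natural map
`ℋ^{0,q}(E) → H^q(X, 𝓔)` … is an isomorphism", with `E = Ω^p_X`, Rem. 5.11, so that
`ℋ^{p,q} ≅ H^{p,q}_{∂̄}(X)`; it rests on Thm. 5.22, the elliptic package, "which we will use without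
proof"); D. Huybrechts, *Complex Geometry* (2005), §3.2, Cor. 3.2.9 ("Let `(X, g)` be a compact
hermitian manifold. Then the canonical projection `ℋ^{p,q}_{∂̄}(X, g) → H^{p,q}(X)` is an
isomorphism") — as the named fact
`Literature.NumberTheory.Transcendental.existsUnique_isDolbeaultHarmonic_mk_eq g o` ("every Dolbeault
class `c ∈ H^{p,q}_{∂̄}(M)` of a compact Hermitian manifold has a unique `Δ_∂̄`-harmonic
representative"), a `def … : Prop` written in `section Hermitian` after
`variable … [IsManifold 𝓘(ℂ, E) ω M] [IsManifold 𝓘(ℝ, E) ∞ M] (g …) (o …)`.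

**Finding.** The body of the `def` mentions `g` (hence the real tangent bundle and
`[IsManifold 𝓘(ℝ, E) ∞ M]`) but nothing in it uses the *complex*-manifold instance, so Lean did not
abstract it: `#check @existsUnique_isDolbeaultHarmonic_mk_eq` lists
`{E} [NormedAddCommGroup E] [NormedSpace ℂ E] {M} [TopologicalSpace M] [ChartedSpace E M] {m : ℕ}
[FiniteDimensional ℂ E] {n : ℕ} [Fact (finrank ℝ E = n)] [IsManifold 𝓘(ℝ, E) ∞ M] (g) (o)` as its
only binders — the defect shared by every fact of sections `Hermitian` and `Kaehler` of that file
(*Correction* notes in `KaehlerHodge.lean`; `KaehlerHodgeDolbeaultHarmonicCounterexample.lean`,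
`KaehlerHodgeFinrankCounterexample.lean`, `KaehlerHodgeConjCounterexample.lean`, …). The fact is
therefore stated for every compact *real* `C^∞` manifold whose charts take values in `E`, with the
"complex structure" multiplication by `i` in the coordinates of the *preferred chart* `chartAt x` —
not a tensor unless the transition maps are holomorphic — and with `IsOfType`, `∂̄`, `⋆` and `Δ_∂̄`
read chart-wise. This file proves that in that generality the fact is **false**
(`TorusSwapAtlas.not_existsUnique_isDolbeaultHarmonic_mk_eq_torus4`), records the universal closure
over exactly the binders the fact elaborates with (`not_existsUnique_isDolbeaultHarmonic_mk_eq`; also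
the fourfold-level closure `not_forall_existsUnique_isDolbeaultHarmonic_mk_eq`), and hence that no
closed proof `existsUnique_isDolbeaultHarmonic_mk_eq_holds` can exist. At a complex manifold
(`[IsManifold 𝓘(ℂ, E) ω M]`) the intended statement (Voisin, Thm. 5.24; Huybrechts, Cor. 3.2.9) is
the predicate `existsUnique_isDolbeaultHarmonic_mk_eq g o`, which the tree reduces to Warner's
Theorems 6.5 (regularity) and 6.6 (compactness) for `Δ_∂̄` on the spaces `A^{p,q}(M)` — Voisin's
Thm. 5.22 — in `KaehlerHodgeEllipticRepresentativeProofs.lean`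
(`existsUnique_isDolbeaultHarmonic_mk_eq_of_regularity_of_compactness`); that analytic content is
the debt this fact carries, and a second, "corrected" closed copy of the fact with the holomorphic
atlas bound inside is deliberately not vendored here (it would be one more unproved name for the
same debt, cf. the same decision in `KaehlerHodgeFinrankCounterexample.lean`).

Why complex dimension two and bidegree `(2,2)`: a counterexample needs a *compact* `M` (part of the
statement), a non-trivial `∂̄`-exact smooth form of pure chart-wise type (so that uniqueness can fail
inside one Dolbeault class), and a junk value of `Δ_∂̄` making that form "harmonic". On the
`{id, conj}`-rigged `2`-torus of the sibling files every smooth form of chart-type `(1,0)` or `(0,1)`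
vanishes (dense rigging), so `B^{1,1}_{∂̄} = 0` and `Z^{0,1}_{∂̄} = 0` there and uniqueness cannot fail;
on `ℂ²` with frames `{id, (z, w) ↦ (z, w̄)}` switching on a dense set, the smooth forms of chart-type
`(2,1)` include the multiples of `dz ∧ dw ∧ dw̄` (the monomial of `w`-bidegree `(1,1)`, invariant up to
the rigging sign), which is enough.

## The counterexample (`namespace TorusSwapAtlas`, bidegree `(2,2)`)

* `M = T⁴ = T² × T²`, `T² = (ℝ/ℤ)²` (compact Hausdorff), charted on `E = V = ℂ × ℂ` (`n = 4`) by the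
  local inverses of the covering `proj4 : ℂ × ℂ → T⁴` **followed by the frame map**
  `L_q = id × L_{q.2}` (`TorusSwapAtlas.L4`), where `L_{q.2} ∈ {id, conj}` is the frame map of the
  rigged `2`-torus `TorusConjAtlas.T` of `KaehlerHodgeDolbeaultHarmonicCounterexample.lean` on the
  second factor: the second coordinate is conjugated exactly when `Re w` is a rational point of
  `ℝ/ℤ` (a dense, co-dense set). All transition maps are locally `y ↦ L_{q₁}(L_{q₀} y - c)`
  (`transition_eventuallyEq`), so this is a real-analytic atlas (`isManifold4`), the tangent
  coordinate changes are the constants `L_x ∘ L_{x₀}` (`coordChange_eq`) and the chart representative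
  of any form `β` at `x₀` is `y ↦ (L_z ∘ L_{x₀})^* β_z`, `z = proj4 (L_{x₀} y)` (`inChart_apply'`).
* `metric4`: the flat metric `Re ⟪·,·⟫ + Re ⟪·,·⟫` (`OriginSwapAtlas.ip`) on every `T_x T⁴ = ℂ × ℂ`,
  constant in every trivialisation, hence `C^∞`; Hermitian (`isHermitian`). `orient4`: the standard
  orientation read in the preferred charts (reversed at rigged points); its volume form is `ε det4`
  pointwise with constant representatives `ε(x₀) det4` (`isSmoothForm_riemannianVolumeForm`). In every
  chart the representative of `⋆β` is `ε(x₀) Sc`(representative of `β`) (`inChart_cHodgeStar`), `Sc`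
  being the model star of `KaehlerHodgeConjCounterexample.lean`.
* **Coefficient.** `f(q) = e^{2πi Re z} e^{2πi Re w}` (`TorusSwapAtlas.f`, characters of the first
  circle of each factor): smooth, nowhere zero, with lift `F(y) = e^{2πi(Re y₁ + Re y₂)}` in *every*
  chart (`f_proj4_L4`) and `dF = F · πi (dz + dz̄ + dw + dw̄)` (`hasFDerivAt_F`, `G_eq`).
* **`γ = (f ε) · dz ∧ dw ∧ dw̄ ∈ A^{2,1}`** (`gamma`; chart coordinates, `ε` the rigging sign, which
  makes the representatives `y ↦ F(y) ε(x₀) E3₀` smooth, `inChart_gamma`), and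
  **`α := ∂̄γ = (dγ)^{2,2} = dγ = 4πi (f ε) · det4 = 4πi f · vol`** (`dolbeaultBar_gamma`; an honest
  derivative, `mextDeriv_gamma`): a nowhere-vanishing smooth top form, of type `(2,2)`, `∂̄`-closed
  (there are no `5`-forms), so `0 ≠ α ∈ Z^{2,2}_{∂̄} ∩ B^{2,2}_{∂̄}` and `[α] = 0 ∈ H^{2,2}_{∂̄}(T⁴)`.
* **`Δ_∂̄ α = 0`.** In top degree `Δ_∂̄ = ∂̄∂̄*`. Pointwise linear algebra gives `⋆α = 4πi f`
  (`cHodgeStar_alpha`, from `⋆det4 = 1`), `∂(⋆α) = (d(4πi f))^{1,0} = c'(dz + dw)` with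
  `c' = (4πi)(πi) f` (`dolbeault_f0`: in the preferred chart `dw` *is* the `(1,0)`-part of `d Re w`,
  at rigged points it is `dw̄` geometrically), and **`θ := ∂̄*α = -⋆∂⋆α = -(ε c') · Sc(dz + dw)`**
  (`theta_eq`), of type `(2,1)`. The representative of `θ` at `x₀` evaluated on the frame vectors
  `(e₁, e₂, e₃)` — all three fixed by both transition maps `id` and `(z, w) ↦ (z, w̄)` — is the scalar
  `y ↦ i c'(y) ρ(Re y₂)` with `ρ = 1` on irrationals, `-1` on rationals
  (`inChart_thetaF_apply_e123`, using `Sc(ℓ)(e₁, e₂, e₃) = -ℓ(e₄)`), which is continuous at **no**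
  point (`c' ≠ 0` everywhere); hence no representative of `θ` is differentiable anywhere
  (`not_differentiableAt_inChart_thetaF`), Mathlib's `fderiv` returns the junk value `0`, `dθ = 0`
  (`mextDeriv_thetaF`), `∂̄θ = (dθ)^{2,2} = 0` and `Δ_∂̄ α = ∂̄θ = 0` (`dolbeaultLaplacian_alpha`).
* So `α` and `0` are two `Δ_∂̄`-harmonic representatives in `Z^{2,2}_{∂̄}` of the class
  `0 ∈ H^{2,2}_{∂̄}(T⁴)`, and the unique existence asserted by the fact at `(g, o) = (metric4, orient4)`,
  `p = q = 2`, `m = 0`, `c = 0` fails (`not_existsUnique_isDolbeaultHarmonic_mk_eq_torus4`).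

Every identity used holds at every point; the only junk value is the one the fact itself feeds into
`Δ_∂̄` (it quantifies over this real-analytic, non-holomorphic atlas).

## References

* C. Voisin, *Hodge Theory and Complex Algebraic Geometry I*, Cambridge Studies in Advanced
  Mathematics 76 (2002), §5.2.3 Thm. 5.22, §5.3.1 Thm. 5.24 (p. 129), Rem. 5.11 — the intended
  (compact complex manifold) statement. [cite: Voisin2002, §5.3.1 Thm. 5.24]
* D. Huybrechts, *Complex Geometry. An Introduction*, Universitext (2005), §3.2, Cor. 3.2.9 — the
  same statement. [cite: Huybrechts2005, Cor. 3.2.9]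
* F. W. Warner, *Foundations of Differentiable Manifolds and Lie Groups*, GTM 94 (1983), 6.5, 6.6 —
  the analytic inputs to which the tree reduces the intended statement.
-/

noncomputable section

open scoped Manifold ContDiff Topology ComplexConjugate Real
open Bundle Module Set Filter ContinuousAlternatingMap
open Literature.Geometry.Kaehler

namespace Literature.NumberTheory.Transcendental

namespace TorusSwapAtlas

open TorusConjAtlas (T proj continuous_proj proj_sub cov cov_apply cov_symm_proj_eventuallyEq L L_L re_L
  im_L inner_L_L norm_L Flip sgn sgn_mul_sgn sgn_ne_zero)
open OriginSwapAtlas (V A det4 det4_apply e234_apply ip ipL ipL_apply ip_comm ip_self_pos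
  norm_sq_le_ip_self ip_eq_coord fr e₁ e₂ e₃ e₄ linearIndependent_fr det4_fr S hodgeStarFrame_smul_top)

/-! ### The `4`-torus `T⁴ = T² × T²`, charted on `ℂ × ℂ` -/

/-- The `4`-torus `(ℝ/ℤ)² × (ℝ/ℤ)²`. [folklore] -/
abbrev T4 : Type := T × T

/-- The covering projection `ℂ × ℂ → T⁴`. [folklore] -/
def proj4 (v : V) : T4 := (proj v.1, proj v.2)

/-- `proj4` is continuous. [folklore] -/
theorem continuous_proj4 : Continuous proj4 :=
  (continuous_proj.comp continuous_fst).prodMk (continuous_proj.comp continuous_snd)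

/-- `proj4` is additive. [folklore] -/
theorem proj4_sub (v w : V) : proj4 (v - w) = proj4 v - proj4 w := by
  simp only [proj4, Prod.fst_sub, Prod.snd_sub, proj_sub, Prod.mk_sub_mk]

/-- `(proj4 v).1 = proj v.1`. [folklore] -/
@[simp] theorem proj4_fst (v : V) : (proj4 v).1 = proj v.1 := rfl

/-- `(proj4 v).2 = proj v.2`. [folklore] -/
@[simp] theorem proj4_snd (v : V) : (proj4 v).2 = proj v.2 := rfl

/-- The local inverse of `proj4` on a product of boxes. [folklore] -/
def cov4 (a b c d : ℝ) : OpenPartialHomeomorph V T4 := (cov a b).prod (cov c d)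

/-- `cov4` acts as `proj4`. [folklore] -/
@[simp] theorem cov4_apply (a b c d : ℝ) (v : V) : cov4 a b c d v = proj4 v := rfl

/-! ### The rigging: conjugate the second coordinate where `Re w` is rational -/

/-- The sign `ε(q) = -1` at rigged points (second factor rigged), `+1` elsewhere. [folklore] -/
def sgn4 (q : T4) : ℝ := sgn q.2

/-- `ε² = 1`. [folklore] -/
@[simp] theorem sgn4_mul_sgn4 (q : T4) : sgn4 q * sgn4 q = 1 := sgn_mul_sgn q.2

/-- `ε ≠ 0`. [folklore] -/
theorem sgn4_ne_zero (q : T4) : sgn4 q ≠ 0 := sgn_ne_zero q.2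

/-- **The frame map** `L_q = id × L_{q.2}`: the identity at unrigged points, `(z, w) ↦ (z, w̄)` at
rigged ones. [folklore] -/
def L4 (q : T4) : V →L[ℝ] V := (ContinuousLinearMap.id ℝ ℂ).prodMap (L q.2)

/-- `L_q (z, w) = (z, L_{q.2} w)`. [folklore] -/
@[simp] theorem L4_apply (q : T4) (v : V) : L4 q v = (v.1, L q.2 v.2) := rfl

/-- `L_q` is an involution. [folklore] -/
@[simp] theorem L4_L4 (q : T4) (v : V) : L4 q (L4 q v) = v := by
  simp only [L4_apply, L_L]

/-- `L_q` is orthogonal for the sum inner product. [folklore] -/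
theorem ip_L4_L4 (q : T4) (v w : V) : ip (L4 q v) (L4 q w) = ip v w := by
  simp only [ip, L4_apply, inner_L_L]

/-- `L_q` acts on the standard volume by the sign `ε(q)`. [folklore] -/
theorem det4_comp_L4 (q : T4) (v : Fin 4 → V) : det4 (fun i ↦ L4 q (v i)) = sgn4 q * det4 v := by
  simp only [det4_apply, e234_apply, L4_apply, re_L, im_L, sgn4, Matrix.cons_val_zero,
    Matrix.cons_val_one, Matrix.cons_val]
  ring

/-- `L_q` as a continuous linear automorphism (its own inverse). [folklore] -/
def Le4 (q : T4) : V ≃L[ℝ] V := ContinuousLinearEquiv.equivOfInverse (L4 q) (L4 q) (L4_L4 q) (L4_L4 q)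

/-- `L_q` as a global open partial homeomorphism. [folklore] -/
def frame4 (q : T4) : OpenPartialHomeomorph V V := (Le4 q).toHomeomorph.toOpenPartialHomeomorph

/-- `frame4 q` acts as `L_q`. [folklore] -/
@[simp] theorem frame4_apply (q : T4) (y : V) : frame4 q y = L4 q y := rfl

/-- `(frame4 q)⁻¹` acts as `L_q`. [folklore] -/
@[simp] theorem frame4_symm_apply (q : T4) (y : V) : (frame4 q).symm y = L4 q y := rfl

/-- `frame4 q` is global. [folklore] -/
@[simp] theorem frame4_source (q : T4) : (frame4 q).source = univ := rfl

/-- `frame4 q` is onto. [folklore] -/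
@[simp] theorem frame4_target (q : T4) : (frame4 q).target = univ := rfl

/-- The covering piece centred at (a lift of) `q`. [folklore] -/
def box (q : T4) : OpenPartialHomeomorph V T4 :=
  cov4 (TorusRough.shift q.1.1) (TorusRough.shift q.1.2) (TorusRough.shift q.2.1) (TorusRough.shift q.2.2)

/-- `q` lies in the target of its covering piece. [folklore] -/
theorem mem_box_target (q : T4) : q ∈ (box q).target :=
  ⟨⟨TorusRough.ne_coe_shift q.1.1, TorusRough.ne_coe_shift q.1.2⟩,
    ⟨TorusRough.ne_coe_shift q.2.1, TorusRough.ne_coe_shift q.2.2⟩⟩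

/-- **The preferred chart of `T⁴` at `q`**: the inverse of the covering piece followed by `L_q`.
[folklore] -/
def chart4 (q : T4) : OpenPartialHomeomorph T4 V := (box q).symm ≫ₕ frame4 q

/-- The source of the preferred chart is the target of the covering piece. [folklore] -/
theorem chart4_source (q : T4) : (chart4 q).source = (box q).target := by
  rw [chart4, OpenPartialHomeomorph.trans_source, frame4_source, preimage_univ, inter_univ,
    OpenPartialHomeomorph.symm_source]

/-- `q` lies in the source of its preferred chart. [folklore] -/
theorem mem_chart4_source (q : T4) : q ∈ (chart4 q).source := by
  rw [chart4_source]
  exact mem_box_target q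

/-- The inverse of the preferred chart at `q` is `proj4 ∘ L_q`. [folklore] -/
@[simp] theorem chart4_symm_apply (q : T4) (y : V) : (chart4 q).symm y = proj4 (L4 q y) := rfl

/-- The preferred chart at `q` is `L_q` after the local inverse of `proj4`. [folklore] -/
theorem chart4_apply (q : T4) (x : T4) : chart4 q x = L4 q ((box q).symm x) := rfl

/-- **The rigged charted-space structure on `T⁴`** modelled on `ℂ × ℂ` (a `def`, used as a local
instance and supplied explicitly to the fact under refutation). [folklore] -/
@[reducible]
def chartedSpace4 : ChartedSpace V T4 where
  atlas := range chart4
  chartAt := chart4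
  mem_chart_source := mem_chart4_source
  chart_mem_atlas q := mem_range_self q

/-- Near any `w` with `proj4 w` in the target, `(box q)⁻¹ ∘ proj4` is a translation. [folklore] -/
theorem box_symm_proj4_eventuallyEq (q : T4) (w : V) (hw : proj4 w ∈ (box q).target) :
    ∃ c : V, (fun z ↦ (box q).symm (proj4 z)) =ᶠ[𝓝 w] fun z ↦ z - c := by
  obtain ⟨c₁, h₁⟩ := cov_symm_proj_eventuallyEq (TorusRough.shift q.1.1) (TorusRough.shift q.1.2) w.1 hw.1
  obtain ⟨c₂, h₂⟩ := cov_symm_proj_eventuallyEq (TorusRough.shift q.2.1) (TorusRough.shift q.2.2) w.2 hw.2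
  refine ⟨(c₁, c₂), ?_⟩
  have h₁' := h₁.comp_tendsto (continuous_fst.tendsto w)
  have h₂' := h₂.comp_tendsto (continuous_snd.tendsto w)
  filter_upwards [h₁', h₂'] with z hz1 hz2
  simp only [Function.comp_apply] at hz1 hz2
  exact Prod.ext hz1 hz2

/-- **The transition maps are locally affine**: near a point of the overlap,
`chart4 q₁ ∘ (chart4 q₀)⁻¹ = L_{q₁} (L_{q₀} (·) - c)`. [folklore] -/
theorem transition_eventuallyEq (q₀ q₁ : T4) {y : V} (hy : proj4 (L4 q₀ y) ∈ (chart4 q₁).source) :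
    ∃ c : V, (fun y ↦ chart4 q₁ ((chart4 q₀).symm y)) =ᶠ[𝓝 y] fun y ↦ L4 q₁ (L4 q₀ y - c) := by
  rw [chart4_source] at hy
  obtain ⟨c, hc⟩ := box_symm_proj4_eventuallyEq q₁ (L4 q₀ y) hy
  refine ⟨c, ?_⟩
  have hc' := hc.comp_tendsto (L4 q₀).continuous.continuousAt
  filter_upwards [hc'] with y' hy'
  simp only [Function.comp_apply] at hy'
  rw [chart4_symm_apply, chart4_apply, hy']

section Charts

attribute [local instance] chartedSpace4

/-- The preferred chart at `q` is `chart4 q`. [folklore] -/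
theorem chartAt_eq (q : T4) : chartAt V q = chart4 q := rfl

/-- **`T⁴` with the rigged atlas is a real `C^∞` manifold.** [folklore] -/
theorem isManifold4 : IsManifold 𝓘(ℝ, V) ∞ T4 := by
  refine isManifold_of_contDiffOn _ _ _ ?_
  rintro e e' ⟨q₀, rfl⟩ ⟨q₁, rfl⟩
  intro y hy
  simp only [modelWithCornersSelf_coe, modelWithCornersSelf_coe_symm, Set.preimage_id,
    Set.range_id, Set.inter_univ, Function.comp_id, Function.id_comp] at hy ⊢
  have hy1 : proj4 (L4 q₀ y) ∈ (chart4 q₁).source := by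
    have := hy.2
    simpa using this
  obtain ⟨c, hc⟩ := transition_eventuallyEq q₀ q₁ hy1
  have hsm : ContDiff ℝ ∞ (fun y ↦ L4 q₁ (L4 q₀ y - c)) :=
    (L4 q₁).contDiff.comp ((L4 q₀).contDiff.sub contDiff_const)
  change ContDiffWithinAt ℝ ∞ (fun y ↦ chart4 q₁ ((chart4 q₀).symm y)) _ y
  exact (hsm.contDiffAt.congr_of_eventuallyEq hc).contDiffWithinAt

attribute [local instance] isManifold4

/-- The inverse extended chart at `q` is `proj4 ∘ L_q`. [folklore] -/
theorem extChartAt_symm_apply (q : T4) (y : V) : (extChartAt 𝓘(ℝ, V) q).symm y = proj4 (L4 q y) := rfl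

/-- The extended chart at `q`. [folklore] -/
theorem extChartAt_apply (q x : T4) : extChartAt 𝓘(ℝ, V) q x = L4 q ((box q).symm x) := rfl

/-- **`proj4` has manifold derivative `L_{proj4 w}` at `w`.** [folklore] -/
theorem hasMFDerivAt_proj4 (w : V) :
    HasMFDerivAt 𝓘(ℝ, V) 𝓘(ℝ, V) proj4 w (L4 (proj4 w)) := by
  refine ⟨continuous_proj4.continuousAt, ?_⟩
  have hw0 : proj4 w ∈ (box (proj4 w)).target := mem_box_target _
  obtain ⟨c, hc⟩ := box_symm_proj4_eventuallyEq _ w hw0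
  have hwr : writtenInExtChartAt 𝓘(ℝ, V) 𝓘(ℝ, V) w proj4 =
      fun z ↦ L4 (proj4 w) ((box (proj4 w)).symm (proj4 z)) := by
    funext z
    simp only [writtenInExtChartAt, extChartAt_coe, extChartAt_coe_symm, modelWithCornersSelf_coe,
      modelWithCornersSelf_coe_symm, Function.comp_apply, id_eq]
    rfl
  rw [hwr, ModelWithCorners.Boundaryless.range_eq_univ, hasFDerivWithinAt_univ, extChartAt_self_apply,
    modelWithCornersSelf_coe, id_eq]
  have hd : HasFDerivAt (fun z ↦ L4 (proj4 w) (z - c)) (L4 (proj4 w)) w := by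
    have := (L4 (proj4 w)).hasFDerivAt.comp w ((hasFDerivAt_id w).sub_const c)
    rwa [ContinuousLinearMap.comp_id] at this
  exact hd.congr_of_eventuallyEq (hc.fun_comp (L4 (proj4 w)))

/-- **The derivative of the inverse extended chart** `proj4 ∘ L_{x₀}` at `y` is `L_z ∘ L_{x₀}`,
`z = proj4 (L_{x₀} y)`. [folklore] -/
theorem mfderivWithin_extChartAt_symm (x₀ : T4) (y : V) :
    mfderivWithin 𝓘(ℝ, V) 𝓘(ℝ, V) (↑(extChartAt 𝓘(ℝ, V) x₀).symm) (range 𝓘(ℝ, V)) y =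
      (L4 (proj4 (L4 x₀ y))).comp (L4 x₀) := by
  have h : (↑(extChartAt 𝓘(ℝ, V) x₀).symm : V → T4) = proj4 ∘ L4 x₀ := funext (extChartAt_symm_apply x₀)
  rw [h, ModelWithCorners.Boundaryless.range_eq_univ, mfderivWithin_univ]
  have hL : HasMFDerivAt 𝓘(ℝ, V) 𝓘(ℝ, V) (L4 x₀) y (L4 x₀) :=
    hasMFDerivAt_iff_hasFDerivAt.2 (L4 x₀).hasFDerivAt
  exact ((hasMFDerivAt_proj4 (L4 x₀ y)).comp y hL).mfderiv

/-- The transition `L_z ∘ L_{x₀}`, typed as a map into the tangent space at `z`. [folklore] -/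
def τ4 (x₀ z : T4) : V →L[ℝ] TangentSpace 𝓘(ℝ, V) z := (L4 z).comp (L4 x₀)

/-- `(τ v).1 = v.1`. [folklore] -/
@[simp] theorem fst_τ4 (x₀ z : T4) (v : V) : Prod.fst (τ4 x₀ z v) = v.1 := rfl

/-- `Re (τ v).2 = Re v.2`. [folklore] -/
@[simp] theorem re_snd_τ4 (x₀ z : T4) (v : V) : Complex.re (Prod.snd (τ4 x₀ z v)) = v.2.re := by
  change (L z.2 (L x₀.2 v.2)).re = v.2.re
  rw [re_L, re_L]

/-- `Im (τ v).2 = ε(z) ε(x₀) Im v.2`. [folklore] -/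
@[simp] theorem im_snd_τ4 (x₀ z : T4) (v : V) :
    Complex.im (Prod.snd (τ4 x₀ z v)) = sgn4 z * sgn4 x₀ * v.2.im := by
  change (L z.2 (L x₀.2 v.2)).im = _
  rw [im_L, im_L, mul_assoc]
  rfl

/-- `τ` as two applications of `L4`. [folklore] -/
theorem τ4_apply (x₀ z : T4) (v : V) : τ4 x₀ z v = L4 z (L4 x₀ v) := rfl

/-- **Values of the chart representative** of a form on the rigged `4`-torus:
`(α.inChart x₀ y)(v) = α_z (τ v)`, `z = proj4 (L_{x₀} y)`, `τ = L_z ∘ L_{x₀}`. [folklore] -/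
theorem inChart_apply' {F : Type*} [NormedAddCommGroup F] [NormedSpace ℝ F] {k : ℕ}
    (α : MForm 𝓘(ℝ, V) T4 F k) (x₀ : T4) (y : V) (v : Fin k → V) :
    α.inChart x₀ y v = α (proj4 (L4 x₀ y)) (fun i ↦ τ4 x₀ (proj4 (L4 x₀ y)) (v i)) := by
  rw [MForm.inChart_apply]
  simp only [mfderivWithin_extChartAt_symm]
  rfl

/-- The manifold exterior derivative at `x` vanishes as soon as the chart representative at `x`
has derivative `0` at the centre. [folklore] -/
theorem mextDeriv_apply_eq_zero {F : Type*} [NormedAddCommGroup F] [NormedSpace ℝ F] {k : ℕ}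
    {α : MForm 𝓘(ℝ, V) T4 F k} {x : T4}
    (h : fderivWithin ℝ (α.inChart x) (range 𝓘(ℝ, V)) (extChartAt 𝓘(ℝ, V) x x) = 0) :
    mextDeriv α x = 0 := by
  rw [mextDeriv, extDerivWithin, h]
  ext v
  simp [ContinuousAlternatingMap.alternatizeUncurryFin_apply]

/-! ### The flat metric, as a `C^∞` Riemannian metric on the rigged `4`-torus -/

/-- The tangent coordinate change between the charts at `x₀` and `x`, at a point `x` of the overlap,
is the constant map `L_x ∘ L_{x₀}`. [folklore] -/
theorem coordChange_eq {x₀ x : T4} (hx : x ∈ (chartAt V x₀).source) :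
    (tangentBundleCore 𝓘(ℝ, V) T4).coordChange (achart V x₀) (achart V x) x = (L4 x).comp (L4 x₀) := by
  rw [tangentBundleCore_coordChange_achart, ModelWithCorners.Boundaryless.range_eq_univ,
    fderivWithin_univ]
  have hx1 : proj4 (L4 x₀ (chart4 x₀ x)) ∈ (chart4 x).source := by
    have : proj4 (L4 x₀ (chart4 x₀ x)) = x := (chart4 x₀).left_inv hx
    rw [this]
    exact mem_chart4_source x
  obtain ⟨c, hc⟩ := transition_eventuallyEq x₀ x hx1
  have hd : HasFDerivAt (fun y ↦ L4 x (L4 x₀ y - c)) ((L4 x).comp (L4 x₀)) (chart4 x₀ x) :=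
    (L4 x).hasFDerivAt.comp _ ((L4 x₀).hasFDerivAt.sub_const c)
  have heq : (↑(extChartAt 𝓘(ℝ, V) x) ∘ ↑(extChartAt 𝓘(ℝ, V) x₀).symm : V → V) =
      fun y ↦ chart4 x ((chart4 x₀).symm y) := by
    funext y; rfl
  rw [heq]
  exact (hd.congr_of_eventuallyEq hc).fderiv

set_option backward.isDefEq.respectTransparency false in
/-- **The flat metric** `Re ⟪·, ·⟫ + Re ⟪·, ·⟫` on every tangent space `T_x T⁴ = ℂ × ℂ` (rigged chart
coordinates), as a `C^∞` Riemannian metric: its expression in the trivialisation at `x₀` is the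
constant `ip (τ ·) (τ ·) = ip`, `τ = L_x ∘ L_{x₀}` being orthogonal. [folklore] -/
def metric4 : ContMDiffRiemannianMetric 𝓘(ℝ, V) ∞ V (fun x : T4 ↦ TangentSpace 𝓘(ℝ, V) x) where
  inner _ := ipL
  symm _ v w := by
    change ipL v w = ipL w v
    rw [ipL_apply, ipL_apply, ip_comm]
  pos _ v hv := by
    change 0 < ipL v v
    rw [ipL_apply]
    exact ip_self_pos hv
  isVonNBounded _ := by
    change Bornology.IsVonNBounded ℝ {v : V | ipL v v < 1}
    refine (NormedSpace.isVonNBounded_ball ℝ V 1).subset fun v hv ↦ ?_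
    simp only [Set.mem_setOf_eq, ipL_apply] at hv
    rw [Metric.mem_ball, dist_zero_right]
    have h := norm_sq_le_ip_self v
    nlinarith [norm_nonneg v]
  contMDiff := by
    intro x₀
    rw [contMDiffAt_section]
    refine (contMDiffAt_const (c := ipL)).congr_of_eventuallyEq ?_
    filter_upwards [(chartAt V x₀).open_source.mem_nhds (mem_chart_source V x₀)] with x hx
    refine ContinuousLinearMap.ext fun v ↦ ContinuousLinearMap.ext fun w ↦ ?_
    rw [trivializationAt_bilinForm_apply₂, TangentBundle.symmL_trivializationAt_eq_core hx,
      coordChange_eq hx]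
    change ipL (L4 x (L4 x₀ v)) (L4 x (L4 x₀ w)) = ipL v w
    rw [ipL_apply, ipL_apply, ip_L4_L4, ip_L4_L4]

/-- The flat metric as a `RiemannianBundle` structure (a reducible `def`, used as a *local*
instance below; it is the instance `⟨g.toRiemannianMetric⟩` installed by the fact under
refutation). [folklore] -/
@[reducible]
def bundle4 : RiemannianBundle (fun x : T4 ↦ TangentSpace 𝓘(ℝ, V) x) := ⟨metric4.toRiemannianMetric⟩

attribute [local instance] bundle4

/-- `⟪u, v⟫ = ip u v` on `T_x T⁴` for the flat metric. [folklore] -/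
theorem inner_eq (x : T4) (u v : TangentSpace 𝓘(ℝ, V) x) : inner ℝ u v = ip u v := by
  change ipL u v = _
  exact ipL_apply u v

/-- The standard frame as a basis of the tangent space. [folklore] -/
def basisT4 (x : T4) : Basis (Fin 4) ℝ (TangentSpace 𝓘(ℝ, V) x) :=
  basisOfLinearIndependentOfCardEqFinrank linearIndependent_fr
    (by rw [Fintype.card_fin]; exact (OriginSwapAtlas.fact_finrank.out : finrank ℝ V = 4).symm)

/-- The basis is the frame `fr`. [folklore] -/
@[simp] theorem coe_basisT4 (x : T4) : ⇑(basisT4 x) = fr :=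
  coe_basisOfLinearIndependentOfCardEqFinrank _ _

/-- The frame is orthonormal for the flat metric. [folklore] -/
theorem basisT4_orthonormal (x : T4) : Orthonormal ℝ (basisT4 x) := by
  rw [orthonormal_iff_ite]
  intro i j
  rw [inner_eq, ip_eq_coord, coe_basisT4]
  fin_cases i <;> fin_cases j <;> simp [fr]

/-- The standard frame as an orthonormal basis of `T_x T⁴`. [folklore] -/
def onBasis4 (x : T4) : OrthonormalBasis (Fin 4) ℝ (TangentSpace 𝓘(ℝ, V) x) :=
  (basisT4 x).toOrthonormalBasis (basisT4_orthonormal x)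

/-- `onBasis4` has the same vectors as `basisT4`. [folklore] -/
theorem toBasis_onBasis4 (x : T4) : (onBasis4 x).toBasis = basisT4 x :=
  Basis.toBasis_toOrthonormalBasis _ _

/-- `onBasis4` is the frame `fr`. [folklore] -/
@[simp] theorem coe_onBasis4 (x : T4) : ⇑(onBasis4 x) = fr := by
  rw [← OrthonormalBasis.coe_toBasis, toBasis_onBasis4, coe_basisT4]

/-- The standard orientation of `T_x T⁴` (chart coordinates). [folklore] -/
def stdOrient4 (x : T4) : Orientation ℝ (TangentSpace 𝓘(ℝ, V) x) (Fin 4) := (basisT4 x).orientation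

open scoped Classical in
/-- **The orientation family**: the standard orientation of the chart coordinates at unrigged
points, the reversed one at rigged points — i.e. the standard orientation of `ℂ²` read in the
preferred charts. [folklore] -/
def orient4 (x : T4) : Orientation ℝ (TangentSpace 𝓘(ℝ, V) x) (Fin 4) :=
  if Flip x.2 then -stdOrient4 x else stdOrient4 x

/-- The determinant of the frame basis is `det4`. [folklore] -/
theorem basisT4_det_eq (x : T4) (v : Fin 4 → TangentSpace 𝓘(ℝ, V) x) :
    (basisT4 x).det v = det4 v := by
  set D : TangentSpace 𝓘(ℝ, V) x [⋀^Fin 4]→ₗ[ℝ] ℝ := det4.toAlternatingMap with hD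
  have h := congrArg (fun f : TangentSpace 𝓘(ℝ, V) x [⋀^Fin 4]→ₗ[ℝ] ℝ ↦ f v)
    (AlternatingMap.eq_smul_basis_det (basisT4 x) D)
  have h1 : D (basisT4 x) = 1 := by
    rw [hD, coe_basisT4]
    exact det4_fr
  simp only [h1, one_smul] at h
  exact h.symm

/-- The volume form of the standard orientation is `det4`. [folklore] -/
theorem volumeForm_stdOrient4 (x : T4) (v : Fin 4 → TangentSpace 𝓘(ℝ, V) x) :
    (stdOrient4 x).volumeForm v = det4 v := by
  have ho : (onBasis4 x).toBasis.orientation = stdOrient4 x := by rw [toBasis_onBasis4]; rfl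
  rw [Orientation.volumeForm_robust _ (onBasis4 x) ho, toBasis_onBasis4, basisT4_det_eq]

/-- **The volume form of the orientation family is `ε det4`.** [folklore] -/
theorem volumeForm_orient4 (x : T4) (v : Fin 4 → TangentSpace 𝓘(ℝ, V) x) :
    (orient4 x).volumeForm v = sgn4 x * det4 v := by
  unfold orient4 sgn4 TorusConjAtlas.sgn
  split_ifs
  · rw [Orientation.volumeForm_neg_orientation, AlternatingMap.neg_apply, volumeForm_stdOrient4]
    ring
  · rw [volumeForm_stdOrient4]; ring

/-- `vol_o = ε det4` as continuous alternating maps. [folklore] -/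
theorem volumeFormL_orient4 (x : T4) : (orient4 x).volumeFormL = sgn4 x • det4 := by
  ext v
  rw [Orientation.volumeFormL_apply, volumeForm_orient4]
  exact (smul_eq_mul (sgn4 x) (det4 v)).symm

/-- Values of the Riemannian volume form: `vol_x(v) = ε(x) det4(v)`. [folklore] -/
theorem riemannianVolumeForm_apply' (x : T4) (v : Fin 4 → TangentSpace 𝓘(ℝ, V) x) :
    riemannianVolumeForm orient4 x v = sgn4 x * det4 v := by
  rw [Literature.Geometry.Kaehler.riemannianVolumeForm_apply, Orientation.volumeFormL_apply,
    volumeForm_orient4]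

/-- `ε(z) (ε(z) ε(x₀)) = ε(x₀)`. [folklore] -/
theorem sgn4_mul_sgn4_mul_sgn4 (x₀ z : T4) : sgn4 z * (sgn4 z * sgn4 x₀) = sgn4 x₀ := by
  rw [← mul_assoc, sgn4_mul_sgn4, one_mul]

/-- The transition acts on the standard volume by `ε(z) ε(x₀)`. [folklore] -/
theorem det4_comp_τ4 (x₀ z : T4) (v : Fin 4 → V) :
    det4 (fun i ↦ (τ4 x₀ z (v i) : V)) = sgn4 z * sgn4 x₀ * det4 v := by
  change det4 (fun i ↦ L4 z (L4 x₀ (v i))) = _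
  rw [det4_comp_L4 z (fun i ↦ L4 x₀ (v i)), det4_comp_L4, mul_assoc]

/-- The chart representatives of the volume form are the constants `ε(x₀) det4`. [folklore] -/
theorem inChart_riemannianVolumeForm (x₀ : T4) (y : V) :
    (riemannianVolumeForm orient4).inChart x₀ y = sgn4 x₀ • det4 := by
  ext v
  rw [inChart_apply', riemannianVolumeForm_apply', ContinuousAlternatingMap.smul_apply, smul_eq_mul,
    det4_comp_τ4, ← mul_assoc, sgn4_mul_sgn4_mul_sgn4]

/-- **The hypothesis `ho`**: the volume form of `(T⁴, g, o)` is smooth. [folklore] -/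
theorem isSmoothForm_riemannianVolumeForm : IsSmoothForm (riemannianVolumeForm orient4) := by
  intro x
  rw [funext (inChart_riemannianVolumeForm x)]
  exact contDiffWithinAt_const

/-- **The flat metric is Hermitian** for the chart-wise complex structure. [folklore] -/
theorem isHermitian : Bundle.RiemannianMetric.IsHermitian metric4.toRiemannianMetric := by
  intro x v w
  change ipL (Complex.I • show V from v) (Complex.I • show V from w) = ipL (show V from v) (show V from w)
  rw [ipL_apply, ipL_apply, ip_eq_coord, ip_eq_coord]
  simp only [Prod.smul_fst, Prod.smul_snd, smul_eq_mul, Complex.mul_re, Complex.mul_im,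
    Complex.I_re, Complex.I_im]
  ring

/-- The instance form of Hermitian-ness used by `KaehlerHodgeStarTypeProofs`. [folklore] -/
theorem inner_tangentJ_tangentJ (x : T4) (v w : TangentSpace 𝓘(ℝ, V) x) :
    inner ℝ (tangentJ V x v) (tangentJ V x w) = inner ℝ v w :=
  isHermitian x v w

/-! ### Chart formula for the Hodge star -/

/-- Unapplied form of `inChart_apply'`. [folklore] -/
theorem inChart_eq {F : Type*} [NormedAddCommGroup F] [NormedSpace ℝ F] {k : ℕ}
    (α : MForm 𝓘(ℝ, V) T4 F k) (x₀ : T4) (y : V) :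
    α.inChart x₀ y = (α (proj4 (L4 x₀ y))).compContinuousLinearMap (τ4 x₀ (proj4 (L4 x₀ y))) := by
  ext v
  rw [inChart_apply', ContinuousAlternatingMap.compContinuousLinearMap_apply]
  rfl

/-- `τ` is injective (a composition of two involutions). [folklore] -/
theorem τ4_injective (x₀ z : T4) : Function.Injective (τ4 x₀ z) := by
  intro v w h
  have := congrArg (fun u : V ↦ L4 x₀ (L4 z u)) h
  simpa [τ4_apply] using this

/-- The frame transported by the transition map `τ4 x₀ z`, typed into the tangent space at `z`.
[folklore] -/
def frτ4 (x₀ z : T4) : Fin 4 → TangentSpace 𝓘(ℝ, V) z := fun i ↦ τ4 x₀ z (fr i)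

/-- The transported frame is linearly independent. [folklore] -/
theorem linearIndependent_frτ4 (x₀ z : T4) : LinearIndependent ℝ (frτ4 x₀ z) := by
  rw [Fintype.linearIndependent_iff]
  intro g hg
  have h1 : τ4 x₀ z (∑ i, g i • fr i) = 0 := by
    rw [_root_.map_sum]
    simpa only [map_smul, frτ4] using hg
  have h2 : (∑ i, g i • fr i : V) = 0 := by
    have h0 : τ4 x₀ z (∑ i, g i • fr i) = τ4 x₀ z 0 := by rw [h1, _root_.map_zero]
    exact τ4_injective x₀ z h0
  exact (Fintype.linearIndependent_iff.1 linearIndependent_fr) g h2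

/-- The transported frame as a real basis of `T_z T⁴`. [folklore] -/
def basisτ4 (x₀ z : T4) : Basis (Fin 4) ℝ (TangentSpace 𝓘(ℝ, V) z) :=
  basisOfLinearIndependentOfCardEqFinrank (linearIndependent_frτ4 x₀ z)
    (by rw [Fintype.card_fin]; exact (OriginSwapAtlas.fact_finrank.out : finrank ℝ V = 4).symm)

/-- The basis is the transported frame. [folklore] -/
@[simp] theorem coe_basisτ4 (x₀ z : T4) : ⇑(basisτ4 x₀ z) = frτ4 x₀ z :=
  coe_basisOfLinearIndependentOfCardEqFinrank _ _

/-- The transported frame is orthonormal (`τ` is orthogonal). [folklore] -/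
theorem basisτ4_orthonormal (x₀ z : T4) : Orthonormal ℝ (basisτ4 x₀ z) := by
  rw [orthonormal_iff_ite]
  intro i j
  rw [inner_eq, coe_basisτ4]
  change ip (L4 z (L4 x₀ (fr i))) (L4 z (L4 x₀ (fr j))) = _
  rw [ip_L4_L4, ip_L4_L4, ip_eq_coord]
  fin_cases i <;> fin_cases j <;> simp [fr]

/-- The transported frame as an orthonormal basis of `T_z T⁴`. [folklore] -/
def onBasisτ4 (x₀ z : T4) : OrthonormalBasis (Fin 4) ℝ (TangentSpace 𝓘(ℝ, V) z) :=
  (basisτ4 x₀ z).toOrthonormalBasis (basisτ4_orthonormal x₀ z)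

/-- The orthonormal basis is `τ ∘ fr`. [folklore] -/
theorem coe_onBasisτ4 (x₀ z : T4) : ⇑(onBasisτ4 x₀ z) = ⇑(τ4 x₀ z) ∘ fr := by
  rw [onBasisτ4, ← OrthonormalBasis.coe_toBasis, Basis.toBasis_toOrthonormalBasis, coe_basisτ4]
  rfl

/-- The volume form pulled back along the transition is the constant `ε(x₀) det4`. [folklore] -/
theorem volumeFormL_comp_τ4 (x₀ z : T4) :
    (orient4 z).volumeFormL.compContinuousLinearMap (τ4 x₀ z) = sgn4 x₀ • det4 := by
  ext v
  rw [ContinuousAlternatingMap.compContinuousLinearMap_apply, Orientation.volumeFormL_apply,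
    volumeForm_orient4, ContinuousAlternatingMap.smul_apply, smul_eq_mul]
  change sgn4 z * det4 (fun i ↦ (τ4 x₀ z (v i) : V)) = _
  rw [det4_comp_τ4, ← mul_assoc, sgn4_mul_sgn4_mul_sgn4]

/-- **Chart formula for the Hodge star of `(T⁴, g, o)`**: in every chart, the representative of
`⋆α` is `ε(x₀) S` of the representative of `α`, where `S` is the inner-product-free frame star of
the model (`OriginSwapAtlas.S`, the frame `fr` and the top form `det4`). [folklore] -/
theorem inChart_hodgeStar {k m : ℕ} (h : k + m = 4) (α : MForm 𝓘(ℝ, V) T4 ℝ k) (x₀ : T4) (y : V) :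
    (MForm.hodgeStar orient4 h α).inChart x₀ y = sgn4 x₀ • S k h (α.inChart x₀ y) := by
  rw [inChart_eq, inChart_eq, MForm.hodgeStar_apply]
  set z := proj4 (L4 x₀ y)
  rw [hodgeStar_eq_hodgeStarFrame (orient4 z) (onBasisτ4 x₀ z) h (α z), coe_onBasisτ4]
  change (hodgeStarFrame k (⇑(τ4 x₀ z) ∘ fr) (orient4 z).volumeFormL h (α z)).compContinuousLinearMap
    (τ4 x₀ z) = sgn4 x₀ • S k h ((α z).compContinuousLinearMap (τ4 x₀ z))
  rw [hodgeStarFrame_compContinuousLinearMap, volumeFormL_comp_τ4, hodgeStarFrame_smul_top]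
  rfl

/-- Real parts of representatives. [folklore] -/
theorem inChart_re {k : ℕ} (β : MForm 𝓘(ℝ, V) T4 ℂ k) (x₀ : T4) (y : V) :
    β.re.inChart x₀ y = OriginSwapAtlas.reP (β.inChart x₀ y) := by
  ext v
  rw [inChart_apply']
  change _ = Complex.re (β.inChart x₀ y v)
  rw [inChart_apply']
  rfl

/-- Imaginary parts of representatives. [folklore] -/
theorem inChart_im {k : ℕ} (β : MForm 𝓘(ℝ, V) T4 ℂ k) (x₀ : T4) (y : V) :
    β.im.inChart x₀ y = OriginSwapAtlas.imP (β.inChart x₀ y) := by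
  ext v
  rw [inChart_apply']
  change _ = Complex.im (β.inChart x₀ y v)
  rw [inChart_apply']
  rfl

/-- Complexifications of representatives. [folklore] -/
theorem inChart_ofReal {k : ℕ} (γ : MForm 𝓘(ℝ, V) T4 ℝ k) (x₀ : T4) (y : V) :
    γ.ofReal.inChart x₀ y = OriginSwapAtlas.ofR (γ.inChart x₀ y) := by
  ext v
  rw [inChart_apply']
  change _ = ((γ.inChart x₀ y v : ℝ) : ℂ)
  rw [inChart_apply']
  rfl

/-- **Chart formula for the complex Hodge star of `(T⁴, g, o)`.** [folklore] -/
theorem inChart_cHodgeStar {k m : ℕ} (h : k + m = 4) (β : MForm 𝓘(ℝ, V) T4 ℂ k) (x₀ : T4) (y : V) :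
    (MForm.cHodgeStar orient4 h β).inChart x₀ y = (sgn4 x₀ : ℂ) • OriginSwapAtlas.Sc k h (β.inChart x₀ y) := by
  rw [MForm.cHodgeStar_apply, MForm.inChart_add, Pi.add_apply, MForm.inChart_smul_complex,
    Pi.smul_apply, inChart_ofReal, inChart_ofReal, inChart_hodgeStar, inChart_hodgeStar, inChart_re,
    inChart_im, OriginSwapAtlas.Sc, smul_add]
  congr 1
  · ext v; simp
  · ext v; simp only [ContinuousAlternatingMap.smul_apply, smul_eq_mul,
      ContinuousLinearMap.compContinuousAlternatingMap_coe, Function.comp_apply,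
      Complex.ofRealCLM_apply, Complex.ofReal_mul]
    ring

/-- The representative at `x`, at the centre of the chart, is the value at `x`. [folklore] -/
theorem inChart_self {F : Type*} [NormedAddCommGroup F] [NormedSpace ℝ F] {k : ℕ}
    (γ : MForm 𝓘(ℝ, V) T4 F k) (x : T4) : γ.inChart x (extChartAt 𝓘(ℝ, V) x x) = γ x := by
  have key : ∀ (z : T4), z = x → ∀ (w : Fin k → V), γ z (fun i ↦ τ4 x z (w i)) = γ x w := by
    rintro z rfl w
    have : ∀ i, (τ4 z z (w i) : V) = w i := fun i ↦ L4_L4 z (w i)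
    exact congrArg (γ z) (funext this)
  ext w
  rw [inChart_apply']
  exact key _ ((extChartAt 𝓘(ℝ, V) x).left_inv (mem_extChartAt_source x)) w

/-! ### The coefficient function `f = e^{2πi(Re z + Re w)}` -/

/-- The character `t ↦ e^{2πit}` of `ℝ/ℤ`, complex-valued. [folklore] -/
def ch (t : AddCircle (1 : ℝ)) : ℂ := (AddCircle.toCircle t : ℂ)

/-- `ch x = e^{2πix}` on representatives. [folklore] -/
theorem ch_coe (x : ℝ) : ch (x : AddCircle (1 : ℝ)) = Complex.exp ((2 * π * x : ℝ) * Complex.I) := by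
  rw [ch, AddCircle.toCircle_apply_mk, Circle.coe_exp, div_one]

/-- The character never vanishes. [folklore] -/
theorem ch_ne_zero (t : AddCircle (1 : ℝ)) : ch t ≠ 0 := Circle.coe_ne_zero _

/-- **The coefficient function** `f(q) = e^{2πi Re z} e^{2πi Re w}` on `T⁴` (the product of the
characters of the first circle of each factor); smooth and nowhere zero. [folklore] -/
def f (q : T4) : ℂ := ch q.1.1 * ch q.2.1

/-- `f` never vanishes. [folklore] -/
theorem f_ne_zero (q : T4) : f q ≠ 0 := mul_ne_zero (ch_ne_zero _) (ch_ne_zero _)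

/-- The real functional `Re z + Re w` of the model. [folklore] -/
def sL : V →L[ℝ] ℝ := OriginSwapAtlas.xL + OriginSwapAtlas.uL

/-- `sL v = Re v.1 + Re v.2`. [folklore] -/
@[simp] theorem sL_apply (v : V) : sL v = v.1.re + v.2.re := rfl

/-- The exponent `2πi (Re z + Re w)` as a real-linear functional. [folklore] -/
def G : V →L[ℝ] ℂ := (2 * π * Complex.I) • Complex.ofRealCLM.comp sL

/-- `G v = 2πi (Re v.1 + Re v.2)`. [folklore] -/
@[simp] theorem G_apply (v : V) : G v = 2 * π * Complex.I * ((v.1.re + v.2.re : ℝ) : ℂ) := by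
  simp [G]

/-- **The lift `F = f ∘ proj4`** of the coefficient function: `F(y) = e^{2πi(Re y₁ + Re y₂)}`.
[folklore] -/
def F (y : V) : ℂ := Complex.exp (G y)

/-- `F` never vanishes. [folklore] -/
theorem F_ne_zero (y : V) : F y ≠ 0 := Complex.exp_ne_zero _

/-- `F` is smooth. [folklore] -/
theorem contDiff_F : ContDiff ℝ ∞ F := Complex.contDiff_exp.comp G.contDiff

/-- The derivative of `F` at `y`: `h ↦ F(y) G(h)`. [folklore] -/
def F' (y : V) : V →L[ℝ] ℂ := (F y • (1 : ℂ →L[ℝ] ℂ)).comp G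

/-- `F'(y)(h) = F(y) G(h)`. [folklore] -/
@[simp] theorem F'_apply (y h : V) : F' y h = F y * G h := by
  simp [F', smul_eq_mul]

/-- **`dF = F'`.** [folklore] -/
theorem hasFDerivAt_F (y : V) : HasFDerivAt F (F' y) y :=
  (Complex.hasStrictFDerivAt_exp_real (G y)).hasFDerivAt.comp y G.hasFDerivAt

/-- First coordinate of `proj`. [folklore] -/
theorem proj_fst (z : ℂ) : (proj z).1 = ((z.re : ℝ) : AddCircle (1 : ℝ)) := rfl

/-- **`f (proj4 (L_{x₀} y)) = F(y)`** (the frame map does not change real parts). [folklore] -/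
theorem f_proj4_L4 (x₀ : T4) (y : V) : f (proj4 (L4 x₀ y)) = F y := by
  rw [f, proj4_fst, proj4_snd, proj_fst, proj_fst, ch_coe, ch_coe, F, ← Complex.exp_add, G_apply]
  congr 1
  simp only [L4_apply, re_L]
  push_cast
  ring

/-- `f` read in the chart at `x₀`, at the centre, is `f x₀`. [folklore] -/
theorem F_extChartAt (x : T4) : F (extChartAt 𝓘(ℝ, V) x x) = f x := by
  rw [← f_proj4_L4 x]
  exact congrArg f ((extChartAt 𝓘(ℝ, V) x).left_inv (mem_extChartAt_source x))

/-! ### Constant-coefficient forms and function multiples -/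

/-- The form with the same chart-coordinate expression `η` at every point. [folklore] -/
def cform {k : ℕ} (η : V [⋀^Fin k]→L[ℝ] ℂ) : MForm 𝓘(ℝ, V) T4 ℂ k := fun _ ↦ η

/-- Values of `cform`. [folklore] -/
@[simp] theorem cform_apply {k : ℕ} (η : V [⋀^Fin k]→L[ℝ] ℂ) (x : T4) (v : Fin k → V) :
    cform η x v = η v := rfl

/-- Function multiples of a form. [folklore] -/
def fsmul {k : ℕ} (c : T4 → ℂ) (α : MForm 𝓘(ℝ, V) T4 ℂ k) : MForm 𝓘(ℝ, V) T4 ℂ k := fun x ↦ c x • α x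

/-- Values of `fsmul`. [folklore] -/
@[simp] theorem fsmul_apply {k : ℕ} (c : T4 → ℂ) (α : MForm 𝓘(ℝ, V) T4 ℂ k) (x : T4) :
    fsmul c α x = c x • α x := rfl

/-- On `T⁴`, `tangentRotate` is the model rotation `rot`. [folklore] -/
theorem tangentRotate_eq_rot (x : T4) (θ : ℝ) (v : TangentSpace 𝓘(ℝ, V) x) :
    tangentRotate V x θ v = OriginSwapAtlas.rot θ v := rfl

/-- A constant-coefficient form has type `(p,q)` iff its value has weight `p - q`. [folklore] -/
theorem isOfType_cform {k p q : ℕ} {η : V [⋀^Fin k]→L[ℝ] ℂ} (hpq : p + q = k)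
    (h : OriginSwapAtlas.HasWeight ((p : ℤ) - q) η) : IsOfType p q (cform η) := by
  refine ⟨hpq, fun x θ v ↦ ?_⟩
  have := h θ v
  push_cast at this ⊢
  exact this

/-- Function multiples preserve the type. [folklore] -/
theorem isOfType_fsmul {k p q : ℕ} (c : T4 → ℂ) {α : MForm 𝓘(ℝ, V) T4 ℂ k} (hα : IsOfType p q α) :
    IsOfType p q (fsmul c α) :=
  ⟨hα.1, fun x θ v ↦ by
    simp only [fsmul_apply, ContinuousAlternatingMap.smul_apply, hα.2 x θ v, smul_eq_mul]; ring⟩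

/-- Type projection of a typed function multiple: itself. [folklore] -/
theorem typeComponent_fsmul_self {k p q : ℕ} (c : T4 → ℂ) {α : MForm 𝓘(ℝ, V) T4 ℂ k}
    (hα : IsOfType p q α) : (fsmul c α).typeComponent p q = fsmul c α :=
  (isOfType_fsmul c hα).typeComponent_eq_self

/-- Type projection of a typed function multiple onto another type: `0`. [folklore] -/
theorem typeComponent_fsmul_of_ne {k p q p' q' : ℕ} (c : T4 → ℂ) {α : MForm 𝓘(ℝ, V) T4 ℂ k}
    (hα : IsOfType p q α) (hne : p ≠ p' ∨ q ≠ q') : (fsmul c α).typeComponent p' q' = 0 :=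
  IsOfType.typeComponent_of_ne_holds (isOfType_fsmul c hα) hne

/-- `d` in charts (range of the model is everything). [folklore] -/
theorem mextDeriv_eq_extDeriv {F : Type*} [NormedAddCommGroup F] [NormedSpace ℝ F] {k : ℕ}
    (α : MForm 𝓘(ℝ, V) T4 F k) (x : T4) :
    mextDeriv α x = extDeriv (α.inChart x) (extChartAt 𝓘(ℝ, V) x x) := by
  rw [mextDeriv_eq_extDerivWithin, ModelWithCorners.Boundaryless.range_eq_univ, extDerivWithin_univ]

/-- A form all of whose chart representatives are `C^∞` is smooth. [folklore] -/
theorem isSmoothForm_of_contDiff {F : Type*} [NormedAddCommGroup F] [NormedSpace ℝ F] {k : ℕ}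
    {α : MForm 𝓘(ℝ, V) T4 F k} (h : ∀ x₀, ContDiff ℝ ∞ (α.inChart x₀)) : IsSmoothForm α := fun x ↦
  (h x).contDiffAt.contDiffWithinAt

/-! ### The `(2,1)`-form `γ = f · dz ∧ dw ∧ dw̄` -/

open OriginSwapAtlas (E3₀ dwdwb hasWeight_E3₀ wedge1 wedge1_two_apply wedge1_form1_apply
  wedge1_three_apply zL wL wbL zL_apply wL_apply wbL_apply det4c det4c_apply top_eq_smul_det4c
  extDeriv_smul_const_of_hasFDerivAt wedge1_smul_left form1 form1_apply Sc Sc_det4c Sc_form1_apply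
  Sc_smul Sc_add dz₀ dw₀ dzb₀ dwb₀ hasWeight_dz₀ hasWeight_dw₀ hasWeight_dzb₀ hasWeight_dwb₀ HasWeight)

/-- Values of `dw ∧ dw̄` transform by the sign of the transition `L_z ∘ L_{x₀}`. [folklore] -/
theorem dwdwb_L4L4 (x₀ z : T4) (a b : V) :
    dwdwb ![L4 z (L4 x₀ a), L4 z (L4 x₀ b)] = ((sgn4 z * sgn4 x₀ : ℝ) : ℂ) * dwdwb ![a, b] := by
  simp only [dwdwb, dwb₀, wedge1_form1_apply, Matrix.cons_val_zero, Matrix.cons_val_one, wL_apply,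
    wbL_apply, L4_apply]
  apply Complex.ext
  · simp only [Complex.sub_re, Complex.mul_re, Complex.conj_re, Complex.conj_im, Complex.ofReal_re,
      Complex.ofReal_im, re_L, im_L, sgn4]
    ring
  · simp only [Complex.sub_im, Complex.mul_im, Complex.mul_re, Complex.conj_re, Complex.conj_im,
      Complex.ofReal_re, Complex.ofReal_im, Complex.sub_re, re_L, im_L, sgn4]
    ring

/-- **Values of `dz ∧ dw ∧ dw̄` transform by the sign of the transition.** [folklore] -/
theorem E3₀_L4L4 (x₀ z : T4) (v : Fin 3 → V) :
    E3₀ (fun i ↦ L4 z (L4 x₀ (v i))) = ((sgn4 z * sgn4 x₀ : ℝ) : ℂ) * E3₀ v := by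
  have h12 := dwdwb_L4L4 x₀ z (v 1) (v 2)
  have h02 := dwdwb_L4L4 x₀ z (v 0) (v 2)
  have h01 := dwdwb_L4L4 x₀ z (v 0) (v 1)
  simp only [E3₀, wedge1_two_apply, zL_apply] at h12 h02 h01 ⊢
  have e1 : (L4 z (L4 x₀ (v 0))).1 = (v 0).1 := rfl
  have e2 : (L4 z (L4 x₀ (v 1))).1 = (v 1).1 := rfl
  have e3 : (L4 z (L4 x₀ (v 2))).1 = (v 2).1 := rfl
  rw [e1, e2, e3, h12, h02, h01]
  ring

/-- **The form `γ = (f ε) · dz ∧ dw ∧ dw̄`** (chart coordinates; the sign `ε` makes it smooth),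
a smooth `3`-form of type `(2,1)`. [folklore] -/
def gamma : MForm 𝓘(ℝ, V) T4 ℂ 3 := fsmul (fun x ↦ f x * sgn4 x) (cform E3₀)

/-- **The chart representatives of `γ`** are `y ↦ (F(y) ε(x₀)) • E3₀`. [folklore] -/
theorem inChart_gamma (x₀ : T4) (y : V) : gamma.inChart x₀ y = (F y * sgn4 x₀) • E3₀ := by
  ext v
  rw [inChart_apply']
  change (f (proj4 (L4 x₀ y)) * sgn4 (proj4 (L4 x₀ y))) • E3₀ (fun i ↦ L4 (proj4 (L4 x₀ y)) (L4 x₀ (v i))) =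
    ((F y * sgn4 x₀) • E3₀) v
  rw [f_proj4_L4, E3₀_L4L4, ContinuousAlternatingMap.smul_apply, smul_eq_mul, smul_eq_mul]
  have hs : (sgn4 (proj4 (L4 x₀ y)) : ℂ) * ((sgn4 (proj4 (L4 x₀ y)) : ℂ) * (sgn4 x₀ : ℂ)) = sgn4 x₀ := by
    exact_mod_cast sgn4_mul_sgn4_mul_sgn4 x₀ (proj4 (L4 x₀ y))
  push_cast
  linear_combination (F y * E3₀ v) * hs

/-- `γ` is smooth. [folklore] -/
theorem isSmoothForm_gamma : IsSmoothForm gamma := by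
  refine isSmoothForm_of_contDiff fun x₀ ↦ ?_
  rw [funext (inChart_gamma x₀)]
  exact (contDiff_F.mul contDiff_const).smul contDiff_const

/-- `γ` has type `(2,1)`. [folklore] -/
theorem isOfType_gamma : IsOfType 2 1 gamma :=
  isOfType_fsmul _ (isOfType_cform rfl (by simpa using hasWeight_E3₀))

/-- `γ ∈ A^{2,1}(T⁴)`. [folklore] -/
theorem gamma_mem_pqForms : gamma ∈ pqForms V T4 2 1 :=
  (mem_pqForms_iff _).2 ⟨isSmoothForm_gamma, isOfType_gamma⟩

/-! ### The top-degree form `α = ∂̄γ = 4πi f · vol` -/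

/-- Rotations have determinant `1`: `det4 (e^{iθ} fr) = 1`. [folklore] -/
theorem det4_rot_fr (θ : ℝ) : det4 (fun i ↦ OriginSwapAtlas.rot θ (fr i)) = 1 := by
  simp only [det4_apply, e234_apply, fr, OriginSwapAtlas.rot_apply, Matrix.cons_val_zero,
    Matrix.cons_val_one, Matrix.cons_val, Prod.smul_fst, Prod.smul_snd, smul_eq_mul,
    OriginSwapAtlas.e₁_fst, OriginSwapAtlas.e₁_snd, OriginSwapAtlas.e₂_fst, OriginSwapAtlas.e₂_snd,
    OriginSwapAtlas.e₃_fst, OriginSwapAtlas.e₃_snd, OriginSwapAtlas.e₄_fst, OriginSwapAtlas.e₄_snd,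
    mul_one, mul_zero, Complex.mul_re, Complex.mul_im, Complex.I_re, Complex.I_im,
    Complex.exp_ofReal_mul_I_re, Complex.exp_ofReal_mul_I_im, Complex.zero_re, Complex.zero_im,
    sub_zero, zero_sub, add_zero, neg_mul]
  linear_combination (Real.cos θ ^ 2 + Real.sin θ ^ 2 + 1) * Real.cos_sq_add_sin_sq θ

/-- **The complexified volume `det4c` has weight `0`** (type `(2,2)`). [folklore] -/
theorem hasWeight_det4c : HasWeight 0 det4c := by
  intro θ v
  have key : det4c.compContinuousLinearMap (OriginSwapAtlas.rot θ) = det4c := by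
    rw [top_eq_smul_det4c (det4c.compContinuousLinearMap (OriginSwapAtlas.rot θ)),
      ContinuousAlternatingMap.compContinuousLinearMap_apply, det4c_apply]
    rw [show (det4 (⇑(OriginSwapAtlas.rot θ) ∘ fr)) = 1 from det4_rot_fr θ]
    simp
  have := congrArg (fun X : V [⋀^Fin 4]→L[ℝ] ℂ ↦ X v) key
  simp only [ContinuousAlternatingMap.compContinuousLinearMap_apply] at this
  rw [Int.cast_zero, zero_mul, zero_mul, Complex.exp_zero, one_mul]
  exact this

/-- The value of `dF ∧ (dz ∧ dw ∧ dw̄)` on the frame: `4πi F`. [folklore] -/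
theorem wedge1_F'_E3₀_fr (y : V) : wedge1 (F' y) E3₀ fr = F y * (4 * π * Complex.I) := by
  simp only [wedge1_three_apply, E3₀, wedge1_two_apply, dwdwb, dwb₀, wedge1_form1_apply, fr,
    Matrix.cons_val_zero, Matrix.cons_val_one, Matrix.cons_val, F'_apply, G_apply, zL_apply, wL_apply,
    wbL_apply, OriginSwapAtlas.e₁_fst, OriginSwapAtlas.e₁_snd, OriginSwapAtlas.e₂_fst,
    OriginSwapAtlas.e₂_snd, OriginSwapAtlas.e₃_fst, OriginSwapAtlas.e₃_snd, OriginSwapAtlas.e₄_fst,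
    OriginSwapAtlas.e₄_snd, _root_.map_one, _root_.map_zero, Complex.conj_I, Complex.one_re,
    Complex.zero_re, Complex.I_re]
  push_cast
  linear_combination (-4 * F y * π * Complex.I) * Complex.I_sq

/-- **`dF ∧ (dz ∧ dw ∧ dw̄) = 4πi F · det4`.** [folklore] -/
theorem wedge1_F'_E3₀ (y : V) : wedge1 (F' y) E3₀ = (F y * (4 * π * Complex.I)) • det4c := by
  rw [top_eq_smul_det4c (wedge1 (F' y) E3₀), wedge1_F'_E3₀_fr]

/-- **`d` of the representatives of `γ`**: `d((F ε) E3₀) = (F ε 4πi) det4`. [folklore] -/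
theorem extDeriv_inChart_gamma (x₀ : T4) (y : V) :
    extDeriv (gamma.inChart x₀) y = (F y * sgn4 x₀ * (4 * π * Complex.I)) • det4c := by
  rw [funext (inChart_gamma x₀),
    extDeriv_smul_const_of_hasFDerivAt ((hasFDerivAt_F y).mul_const (sgn4 x₀ : ℂ)) E3₀,
    wedge1_smul_left, wedge1_F'_E3₀, smul_smul]
  congr 1
  ring

/-- **`dγ = (4πi f ε) · det4`** (an honest derivative at every point). [folklore] -/
theorem mextDeriv_gamma :
    mextDeriv gamma = fsmul (fun x ↦ f x * sgn4 x * (4 * π * Complex.I)) (cform det4c) := by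
  funext x
  rw [mextDeriv_eq_extDeriv, extDeriv_inChart_gamma, F_extChartAt]
  rfl

/-- **The form `α = (4πi f ε) · det4`**, i.e. `α = 4πi f · vol ⊗ 1`: a nowhere-vanishing smooth
top-degree form (type `(2,2)`), which is `∂̄γ` (`dolbeaultBar_gamma`). [folklore] -/
def alpha : MForm 𝓘(ℝ, V) T4 ℂ 4 := fsmul (fun x ↦ f x * sgn4 x * (4 * π * Complex.I)) (cform det4c)

/-- `α` has type `(2,2)`. [folklore] -/
theorem isOfType_alpha : IsOfType 2 2 alpha :=
  isOfType_fsmul _ (isOfType_cform rfl (by simpa using hasWeight_det4c))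

/-- **`∂̄γ = α`**: `∂̄γ = (dγ)^{2,2} = dγ`. [folklore] -/
theorem dolbeaultBar_gamma : dolbeaultBar gamma = alpha := by
  rw [IsOfType.dolbeaultBar_eq_holds isOfType_gamma, mextDeriv_gamma]
  exact typeComponent_fsmul_self _ (isOfType_cform rfl (by simpa using hasWeight_det4c))

/-- Values of `det4c` transform by the sign of the transition. [folklore] -/
theorem det4c_L4L4 (x₀ z : T4) (v : Fin 4 → V) :
    det4c (fun i ↦ L4 z (L4 x₀ (v i))) = ((sgn4 z * sgn4 x₀ : ℝ) : ℂ) * det4c v := by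
  rw [det4c_apply, det4c_apply, det4_comp_L4 z (fun i ↦ L4 x₀ (v i)), det4_comp_L4]
  push_cast
  ring

/-- **The chart representatives of `α`** are `y ↦ (F(y) ε(x₀) 4πi) • det4c`. [folklore] -/
theorem inChart_alpha (x₀ : T4) (y : V) :
    alpha.inChart x₀ y = (F y * sgn4 x₀ * (4 * π * Complex.I)) • det4c := by
  ext v
  rw [inChart_apply']
  change (f (proj4 (L4 x₀ y)) * sgn4 (proj4 (L4 x₀ y)) * (4 * π * Complex.I)) •
      det4c (fun i ↦ L4 (proj4 (L4 x₀ y)) (L4 x₀ (v i))) = ((F y * sgn4 x₀ * (4 * π * Complex.I)) • det4c) v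
  rw [f_proj4_L4, det4c_L4L4, ContinuousAlternatingMap.smul_apply, smul_eq_mul, smul_eq_mul]
  have hs : (sgn4 (proj4 (L4 x₀ y)) : ℂ) * ((sgn4 (proj4 (L4 x₀ y)) : ℂ) * (sgn4 x₀ : ℂ)) = sgn4 x₀ := by
    exact_mod_cast sgn4_mul_sgn4_mul_sgn4 x₀ (proj4 (L4 x₀ y))
  push_cast
  linear_combination (F y * (4 * π * Complex.I) * det4c v) * hs

/-- **`α` is smooth.** [folklore] -/
theorem isSmoothForm_alpha : IsSmoothForm alpha := by
  refine isSmoothForm_of_contDiff fun x₀ ↦ ?_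
  rw [funext (inChart_alpha x₀)]
  exact ((contDiff_F.mul contDiff_const).mul contDiff_const).smul contDiff_const

/-- **`α ≠ 0`** (it vanishes nowhere). [folklore] -/
theorem alpha_ne_zero : alpha ≠ 0 := by
  intro H
  have key := congrArg
    (fun β : MForm 𝓘(ℝ, V) T4 ℂ 4 ↦ β (proj4 0) (fr : Fin 4 → TangentSpace 𝓘(ℝ, V) (proj4 0))) H
  simp only [alpha, fsmul_apply, ContinuousAlternatingMap.smul_apply, cform_apply, det4c_apply, det4_fr,
    Complex.ofReal_one, smul_eq_mul, mul_one, Pi.zero_apply] at key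
  have key' : f (proj4 0) * (sgn4 (proj4 0) : ℂ) * (4 * (π : ℂ) * Complex.I) = 0 := key
  simp [f_ne_zero, sgn4_ne_zero, Real.pi_ne_zero, Complex.I_ne_zero] at key'

/-- Every `5`-covector of the `4`-dimensional model vanishes. [folklore] -/
theorem form5_eq_zero (X : V [⋀^Fin 5]→L[ℝ] ℂ) : X = 0 := by
  ext v
  have hv : ¬ LinearIndependent ℝ v := fun h ↦ by
    have h4 := h.fintype_card_le_finrank
    rw [Fintype.card_fin, (OriginSwapAtlas.fact_finrank.out : finrank ℝ V = 4)] at h4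
    omega
  exact X.toAlternatingMap.map_linearDependent v hv

/-- **`∂̄α = 0`** (there are no `5`-forms). [folklore] -/
theorem dolbeaultBar_alpha : dolbeaultBar alpha = 0 := by
  funext x
  exact form5_eq_zero _

/-- **`α ∈ Z^{2,2}_{∂̄}(T⁴)`**: smooth, of type `(2,2)`, `∂̄`-closed. [folklore] -/
theorem alpha_mem_dolbeaultClosedForms : alpha ∈ dolbeaultClosedForms V T4 2 2 :=
  Submodule.subset_span ⟨isSmoothForm_alpha, isOfType_alpha, dolbeaultBar_alpha⟩

/-- **`α ∈ B^{2,2}_{∂̄}(T⁴)`**: `α = ∂̄γ` with `γ ∈ A^{2,1}`. [folklore] -/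
theorem alpha_mem_dolbeaultExactForms : alpha ∈ dolbeaultExactForms V T4 2 2 := by
  rw [← dolbeaultBar_gamma]
  exact dolbeaultBar_mem_dolbeaultExactForms gamma_mem_pqForms

/-! ### `⋆α`, `∂⋆α` and `θ = ∂̄*α = -⋆∂⋆α` in closed form -/

open OriginSwapAtlas (form1_add form1_smul zbL zbL_apply hasWeight_Sc sharp)

/-- The constant `0`-covector `1` of the model. [folklore] -/
abbrev c1 : V [⋀^Fin 0]→L[ℝ] ℂ := ContinuousAlternatingMap.constOfIsEmpty ℝ V (Fin 0) (1 : ℂ)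

/-- The `0`-form `⋆α = 4πi f` (`⋆vol = 1`). [folklore] -/
def f0 : MForm 𝓘(ℝ, V) T4 ℂ 0 := fsmul (fun x ↦ f x * (4 * π * Complex.I)) (cform c1)

/-- **`⋆α = 4πi f`** (pointwise `⋆(ε det4) = ε ε Sc(det4) = 1`). [folklore] -/
theorem cHodgeStar_alpha (h : 3 + 1 + 0 = 4) : MForm.cHodgeStar orient4 h alpha = f0 := by
  funext x
  rw [← inChart_self (MForm.cHodgeStar orient4 h alpha) x, inChart_cHodgeStar, inChart_alpha, Sc_smul,
    show Sc (3 + 1) h det4c = c1 from Sc_det4c h, F_extChartAt, smul_smul]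
  change ((sgn4 x : ℂ) * (f x * sgn4 x * (4 * π * Complex.I))) • c1 = (f x * (4 * π * Complex.I)) • c1
  have hs : (sgn4 x : ℂ) * (sgn4 x : ℂ) = 1 := by exact_mod_cast sgn4_mul_sgn4 x
  congr 1
  linear_combination (f x * (4 * π * Complex.I)) * hs

/-- The chart representatives of `⋆α` are `y ↦ (4πi F(y)) • 1`. [folklore] -/
theorem inChart_f0 (x₀ : T4) (y : V) : f0.inChart x₀ y = (F y * (4 * π * Complex.I)) • c1 := by
  ext v
  rw [inChart_apply']
  change (f (proj4 (L4 x₀ y)) * (4 * π * Complex.I)) • c1 (fun i ↦ L4 (proj4 (L4 x₀ y)) (L4 x₀ (v i))) = _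
  rw [f_proj4_L4]
  simp

/-- `ℓ ∧ 1 = ℓ` as a `1`-form. [folklore] -/
theorem wedge1_c1 (ℓ : V →L[ℝ] ℂ) : wedge1 ℓ c1 = form1 ℓ := by
  ext v
  simp [OriginSwapAtlas.wedge1_apply, form1_apply]

/-- `F' = F • G`. [folklore] -/
theorem F'_eq (y : V) : F' y = F y • G := by
  ext v <;> simp [F'_apply]

/-- **`G = πi (dz + dz̄ + dw + dw̄)`** (`2 Re z = z + z̄`). [folklore] -/
theorem G_eq : G = ((π : ℂ) * Complex.I) • (zL + zbL + wL + wbL) := by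
  refine ContinuousLinearMap.ext fun v ↦ ?_
  rw [G_apply]
  change _ = (π : ℂ) * Complex.I * (v.1 + conj v.1 + v.2 + conj v.2)
  apply Complex.ext
  · simp only [Complex.mul_re, Complex.mul_im, Complex.add_re, Complex.add_im, Complex.ofReal_re,
      Complex.ofReal_im, Complex.I_re, Complex.I_im, Complex.conj_re, Complex.conj_im, Complex.re_ofNat,
      Complex.im_ofNat]
    ring
  · simp only [Complex.mul_re, Complex.mul_im, Complex.add_re, Complex.add_im, Complex.ofReal_re,
      Complex.ofReal_im, Complex.I_re, Complex.I_im, Complex.conj_re, Complex.conj_im, Complex.re_ofNat,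
      Complex.im_ofNat]
    ring

/-- **`d` of the representatives of `⋆α`**: `d(4πi F) = (4πi)(πi) F (dz + dz̄ + dw + dw̄)`. [folklore] -/
theorem extDeriv_inChart_f0 (x₀ : T4) (y : V) :
    extDeriv (f0.inChart x₀) y =
      (F y * (4 * π * Complex.I) * (π * Complex.I)) • (dz₀ + dzb₀ + dw₀ + dwb₀) := by
  rw [funext (inChart_f0 x₀),
    extDeriv_smul_const_of_hasFDerivAt ((hasFDerivAt_F y).mul_const (4 * π * Complex.I : ℂ)) c1,
    wedge1_c1, form1_smul, F'_eq, form1_smul, G_eq, form1_smul, form1_add, form1_add, form1_add,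
    smul_smul, smul_smul, show dz₀ + dzb₀ + dw₀ + dwb₀ = form1 zL + form1 zbL + form1 wL + form1 wbL from rfl]
  congr 1
  ring

/-- **`d(⋆α) = (4πi)(πi) f · (dz + dz̄ + dw + dw̄)`** (an honest derivative everywhere). [folklore] -/
theorem mextDeriv_f0 : mextDeriv f0 =
    fsmul (fun x ↦ f x * (4 * π * Complex.I) * (π * Complex.I)) (cform (dz₀ + dzb₀ + dw₀ + dwb₀)) := by
  funext x
  rw [mextDeriv_eq_extDeriv, extDeriv_inChart_f0, F_extChartAt]
  rfl

/-- `fsmul`/`cform` distribute over sums of covectors. [folklore] -/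
theorem fsmul_cform_add {k : ℕ} (c : T4 → ℂ) (η η' : V [⋀^Fin k]→L[ℝ] ℂ) :
    fsmul c (cform (η + η')) = fsmul c (cform η) + fsmul c (cform η') := by
  funext x
  change c x • (η + η') = c x • η + c x • η'
  rw [smul_add]

/-- The coefficient `c' = (4πi)(πi) f` of `∂⋆α`. [folklore] -/
def c' (x : T4) : ℂ := f x * (4 * π * Complex.I) * (π * Complex.I)

/-- The `(1,0)`-form `θ₁ = c' (dz + dw)` (chart coordinates: `dw` is `dw̄` geometrically at rigged
points, so `θ₁` is *not* smooth). [folklore] -/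
def theta1 : MForm 𝓘(ℝ, V) T4 ℂ 1 := fsmul c' (cform (dz₀ + dw₀))

/-- **`∂(⋆α) = θ₁`**: only the `(1,0)`-part `c'(dz + dw)` of `d(⋆α) = c'(dz + dz̄ + dw + dw̄)`
survives the chart-wise type projection. [folklore] -/
theorem dolbeault_f0 : dolbeault f0 = theta1 := by
  rw [dolbeault, Finset.Nat.antidiagonal_zero, Finset.sum_singleton,
    (isOfType_zero_zero f0).typeComponent_eq_self, mextDeriv_f0]
  change (fsmul c' (cform (dz₀ + dzb₀ + dw₀ + dwb₀))).typeComponent (0 + 1) 0 = theta1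
  rw [fsmul_cform_add, fsmul_cform_add, fsmul_cform_add, MForm.typeComponent_add,
    MForm.typeComponent_add, MForm.typeComponent_add,
    typeComponent_fsmul_self c' (isOfType_cform (p := 0 + 1) (q := 0) rfl (by simpa using hasWeight_dz₀)),
    typeComponent_fsmul_of_ne c' (isOfType_cform (p := 0) (q := 1) rfl (by simpa using hasWeight_dzb₀))
      (Or.inl (by norm_num)),
    typeComponent_fsmul_self c' (isOfType_cform (p := 0 + 1) (q := 0) rfl (by simpa using hasWeight_dw₀)),
    typeComponent_fsmul_of_ne c' (isOfType_cform (p := 0) (q := 1) rfl (by simpa using hasWeight_dwb₀))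
      (Or.inl (by norm_num)),
    add_zero, add_zero, theta1, fsmul_cform_add]

/-- `1 + 3 = 4`. [folklore] -/
theorem h13 : 1 + 3 = 4 := rfl

/-- The constant covector `Sc(dz + dw)` of the model (type `(2,1)`). [folklore] -/
def Θ₀ : V [⋀^Fin 3]→L[ℝ] ℂ := Sc 1 h13 (dz₀ + dw₀)

/-- `Θ₀` has weight `1` (type `(2,1)`): `Sc` preserves weights. [folklore] -/
theorem hasWeight_Θ₀ : HasWeight 1 Θ₀ := by
  have := hasWeight_Sc h13 (p := 1) (q := 0) (p' := 2) (q' := 1) rfl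
    (by simpa using hasWeight_dz₀.add hasWeight_dw₀) rfl (by norm_num)
  simpa [Θ₀] using this

/-- **The form `θ = -(ε c') · Sc(dz + dw)`** (chart coordinates), which is `∂̄*α` (`theta_eq`).
[folklore] -/
def thetaF : MForm 𝓘(ℝ, V) T4 ℂ 3 := fsmul (fun x ↦ -((sgn4 x : ℂ) * c' x)) (cform Θ₀)

/-- **`∂̄*α = -⋆∂⋆α = θ`** in closed form. [folklore] -/
theorem theta_eq (h : 3 + 1 + 0 = 4) : dolbeaultBarAdjoint orient4 h alpha = thetaF := by
  funext x
  rw [dolbeaultBarAdjoint, cHodgeStar_alpha h, dolbeault_f0, Pi.neg_apply,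
    ← inChart_self (MForm.cHodgeStar orient4 _ theta1) x, inChart_cHodgeStar, inChart_self theta1 x]
  change -((sgn4 x : ℂ) • Sc 1 h13 (c' x • (dz₀ + dw₀))) = (-((sgn4 x : ℂ) * c' x)) • Sc 1 h13 (dz₀ + dw₀)
  rw [Sc_smul, smul_smul, OriginSwapAtlas.cneg_smul]

/-- `θ` has type `(2,1)`. [folklore] -/
theorem isOfType_thetaF : IsOfType 2 1 thetaF :=
  isOfType_fsmul _ (isOfType_cform rfl (by simpa using hasWeight_Θ₀))

/-! ### The junk analysis: the representatives of `θ` jump everywhere, so `dθ = 0` -/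

open TorusConjAtlas (ρ sgn_proj not_continuousAt_ρ)

/-- `L_q 1 = 1`. [folklore] -/
theorem L_one (q : T) : L q 1 = 1 := by
  apply Complex.ext
  · rw [re_L, Complex.one_re]
  · rw [im_L, Complex.one_im, mul_zero]

/-- The transition fixes `e₁`. [folklore] -/
theorem L4L4_e₁ (x₀ z : T4) : L4 z (L4 x₀ e₁) = e₁ := by
  refine Prod.ext rfl ?_
  simp [OriginSwapAtlas.e₁]

/-- The transition fixes `e₂`. [folklore] -/
theorem L4L4_e₂ (x₀ z : T4) : L4 z (L4 x₀ e₂) = e₂ := by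
  refine Prod.ext rfl ?_
  simp [OriginSwapAtlas.e₂]

/-- The transition fixes `e₃`. [folklore] -/
theorem L4L4_e₃ (x₀ z : T4) : L4 z (L4 x₀ e₃) = e₃ := by
  refine Prod.ext rfl ?_
  simp [OriginSwapAtlas.e₃, L_one]

/-- `det4 (a, e₁, e₂, e₃) = -Im a.2` (only the `e₄`-component of `a` survives). [folklore] -/
theorem det4_cons_e123 (a : V) : det4 (Fin.cons a ![e₁, e₂, e₃]) = -a.2.im := by
  rw [det4_apply]
  simp [e234_apply, Fin.cons_zero, OriginSwapAtlas.e₁, OriginSwapAtlas.e₂, OriginSwapAtlas.e₃]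

/-- **`Sc(ℓ)(e₁, e₂, e₃) = -ℓ(e₄)`** for the model star on complex covectors. [folklore] -/
theorem Sc_form1_e123 (ℓ : V →L[ℝ] ℂ) : Sc 1 h13 (form1 ℓ) ![e₁, e₂, e₃] = -ℓ e₄ := by
  rw [Sc_form1_apply, det4_cons_e123, det4_cons_e123]
  simp only [sharp, Prod.snd_add, Prod.smul_snd, OriginSwapAtlas.e₁_snd, OriginSwapAtlas.e₂_snd,
    OriginSwapAtlas.e₃_snd, OriginSwapAtlas.e₄_snd, smul_zero, zero_add, Complex.add_im,
    Complex.real_smul, Complex.mul_im, Complex.ofReal_re, Complex.ofReal_im, Complex.I_re, Complex.I_im,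
    mul_zero, mul_one, add_zero, ContinuousLinearMap.coe_comp, Function.comp_apply, Complex.reCLM_apply,
    Complex.imCLM_apply]
  apply Complex.ext
  · simp
  · simp

/-- `Θ₀ (e₁, e₂, e₃) = -i`. [folklore] -/
theorem Θ₀_e123 : Θ₀ ![e₁, e₂, e₃] = -Complex.I := by
  rw [Θ₀, show dz₀ + dw₀ = form1 (zL + wL) from (form1_add zL wL).symm, Sc_form1_e123]
  simp [OriginSwapAtlas.e₄]

/-- `ε(proj4 (L_{x₀} y)) = ρ(Re y₂)`. [folklore] -/
theorem sgn4_proj4_L4 (x₀ : T4) (y : V) : sgn4 (proj4 (L4 x₀ y)) = ρ y.2.re := by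
  rw [sgn4, proj4_snd, L4_apply, sgn_proj, re_L]

/-- **The chart representative of `θ` evaluated on `(e₁, e₂, e₃)`** is the scalar
`y ↦ i c'(y) ρ(Re y₂)`, which jumps at *every* point. [folklore] -/
theorem inChart_thetaF_apply_e123 (x₀ : T4) (y : V) :
    thetaF.inChart x₀ y ![e₁, e₂, e₃] =
      (F y * (4 * π * Complex.I) * (π * Complex.I) * Complex.I) * ρ y.2.re := by
  rw [inChart_apply']
  have hv : (fun i ↦ L4 (proj4 (L4 x₀ y)) (L4 x₀ ((![e₁, e₂, e₃] : Fin 3 → V) i))) = ![e₁, e₂, e₃] := by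
    funext i
    fin_cases i
    · exact L4L4_e₁ x₀ _
    · exact L4L4_e₂ x₀ _
    · exact L4L4_e₃ x₀ _
  change (-((sgn4 (proj4 (L4 x₀ y)) : ℂ) * c' (proj4 (L4 x₀ y)))) •
      Θ₀ (fun i ↦ L4 (proj4 (L4 x₀ y)) (L4 x₀ ((![e₁, e₂, e₃] : Fin 3 → V) i))) = _
  rw [hv, Θ₀_e123, sgn4_proj4_L4, c', f_proj4_L4, smul_eq_mul]
  ring

/-- `y ↦ ρ(Re y₂)` is continuous nowhere on the model. [folklore] -/
theorem not_continuousAt_ρ_snd_re (y₀ : V) : ¬ ContinuousAt (fun y : V ↦ ρ y.2.re) y₀ := by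
  intro h
  set γp : ℝ → V := fun t ↦ (y₀.1, (t : ℂ) + (y₀.2.im : ℂ) * Complex.I) with hγp
  have hc : Continuous γp := by
    rw [hγp]
    fun_prop
  have h0 : γp y₀.2.re = y₀ := by
    rw [hγp]
    exact Prod.ext rfl (Complex.re_add_im y₀.2)
  have h1 := h.comp_of_eq hc.continuousAt h0
  have hρ : (fun y : V ↦ ρ y.2.re) ∘ γp = ρ := by
    funext t
    simp [γp]
  rw [hρ] at h1
  exact not_continuousAt_ρ _ h1

/-- **The representatives of `θ` are differentiable nowhere.** [folklore] -/
theorem not_differentiableAt_inChart_thetaF (x₀ : T4) (y₀ : V) :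
    ¬ DifferentiableAt ℝ (thetaF.inChart x₀) y₀ := by
  intro hd
  set C : ℂ := (4 * π * Complex.I) * (π * Complex.I) * Complex.I with hC
  have hCne : C ≠ 0 := by
    rw [hC]
    simp [Real.pi_ne_zero, Complex.I_ne_zero]
  have hg : ContinuousAt (fun y ↦ thetaF.inChart x₀ y ![e₁, e₂, e₃]) y₀ :=
    (ContinuousAlternatingMap.apply ℝ V ℂ ![e₁, e₂, e₃]).continuous.continuousAt.comp hd.continuousAt
  have hform : (fun y ↦ thetaF.inChart x₀ y ![e₁, e₂, e₃]) = fun y ↦ (F y * C) * ρ y.2.re := by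
    funext y
    rw [inChart_thetaF_apply_e123, hC]
    ring
  rw [hform] at hg
  have hF : ContinuousAt (fun y ↦ (F y * C)⁻¹) y₀ :=
    ((contDiff_F.continuous.mul continuous_const).continuousAt).inv₀ (mul_ne_zero (F_ne_zero _) hCne)
  have h2 := hF.mul hg
  have heq : ((fun y ↦ (F y * C)⁻¹) * fun y ↦ (F y * C) * (ρ y.2.re : ℂ)) = fun y ↦ ((ρ y.2.re : ℝ) : ℂ) := by
    funext y
    rw [Pi.mul_apply, ← mul_assoc, inv_mul_cancel₀ (mul_ne_zero (F_ne_zero y) hCne), one_mul]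
  rw [heq] at h2
  have h3 := Complex.continuous_re.continuousAt.comp h2
  have heq' : Complex.re ∘ (fun y : V ↦ ((ρ y.2.re : ℝ) : ℂ)) = fun y ↦ ρ y.2.re := by
    funext y
    simp
  rw [heq'] at h3
  exact not_continuousAt_ρ_snd_re y₀ h3

/-- **`dθ = 0` everywhere** (Mathlib's junk value of a nowhere-differentiable representative).
[folklore] -/
theorem mextDeriv_thetaF : mextDeriv thetaF = 0 := by
  funext x
  exact mextDeriv_apply_eq_zero (by
    rw [ModelWithCorners.Boundaryless.range_eq_univ, fderivWithin_univ]
    exact fderiv_zero_of_not_differentiableAt (not_differentiableAt_inChart_thetaF x _))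

/-- **`∂̄θ = 0`**: `θ` has pure type `(2,1)` and `dθ = 0`. [folklore] -/
theorem dolbeaultBar_thetaF : dolbeaultBar thetaF = 0 := by
  rw [IsOfType.dolbeaultBar_eq_holds isOfType_thetaF, mextDeriv_thetaF, MForm.typeComponent_zero]

/-! ### Assembly -/

/-- **`Δ_∂̄ α = 0`**: in top degree `Δ_∂̄ = ∂̄∂̄*`, and `∂̄(∂̄*α) = ∂̄θ = 0`. [folklore] -/
theorem dolbeaultLaplacian_alpha (h : 2 + 2 + 0 = 4) : dolbeaultLaplacian orient4 (2 + 2) 0 h alpha = 0 := by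
  simp only [dolbeaultLaplacian]
  rw [theta_eq, dolbeaultBar_thetaF]

/-- **`α` is `∂̄`-harmonic of type `(2,2)`** on the rigged `4`-torus. [folklore] -/
theorem isDolbeaultHarmonic_alpha (h : 2 + 2 + 0 = 4) : IsDolbeaultHarmonic orient4 2 2 h alpha :=
  ⟨isSmoothForm_alpha, isOfType_alpha, dolbeaultLaplacian_alpha h⟩

/-- **The named fact `existsUnique_isDolbeaultHarmonic_mk_eq` is false for the rigged `4`-torus**
(`E = ℂ × ℂ`, `n = 4`, `m = 0`, bidegree `(2,2)`, the flat `C^∞` metric `metric4`, which is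
Hermitian, and the orientation family `orient4`, whose volume form is smooth): the Dolbeault class
`0 ∈ H^{2,2}_{∂̄}(T⁴)` has the two distinct `Δ_∂̄`-harmonic representatives `0` and `α = ∂̄γ ≠ 0`.
[folklore] -/
theorem not_existsUnique_isDolbeaultHarmonic_mk_eq_torus4 :
    ¬ existsUnique_isDolbeaultHarmonic_mk_eq (m := 0) metric4 orient4 := by
  intro H
  have h4 : (2 + 2 + 0 : ℕ) = 4 := rfl
  obtain ⟨β, -, huniq⟩ := H isHermitian (p := 2) (q := 2) h4 isSmoothForm_riemannianVolumeForm 0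
  have hmk : dolbeaultCohomology.mk V T4 2 2 ⟨alpha, alpha_mem_dolbeaultClosedForms⟩ = 0 := by
    change Submodule.mkQ _ (⟨alpha, alpha_mem_dolbeaultClosedForms⟩ : dolbeaultClosedForms V T4 2 2) = 0
    rw [Submodule.mkQ_apply, Submodule.Quotient.mk_eq_zero, Submodule.mem_comap]
    exact alpha_mem_dolbeaultExactForms
  have h1 := huniq ⟨alpha, alpha_mem_dolbeaultClosedForms⟩ ⟨isDolbeaultHarmonic_alpha h4, hmk⟩
  have h0 := huniq 0 ⟨isDolbeaultHarmonic_zero orient4 rfl h4, map_zero _⟩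
  have h10 : (⟨alpha, alpha_mem_dolbeaultClosedForms⟩ : dolbeaultClosedForms V T4 2 2) = 0 := h1.trans h0.symm
  exact alpha_ne_zero (congrArg Subtype.val h10)

end Charts

end TorusSwapAtlas

section UniversalClosure

attribute [local instance] TorusSwapAtlas.chartedSpace4 TorusSwapAtlas.isManifold4

/-- **`existsUnique_isDolbeaultHarmonic_mk_eq` fails already over compact real `C^∞` fourfolds
charted in `ℂ × ℂ`** (smooth metric, any orientation family), in bidegree `(2,2)`, `m = 0`: witness
the rigged `4`-torus `TorusSwapAtlas.T4` with the flat metric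
(`TorusSwapAtlas.not_existsUnique_isDolbeaultHarmonic_mk_eq_torus4`). The intended statement is
Voisin (2002), Thm. 5.24 / Huybrechts (2005), Cor. 3.2.9, for compact *complex* manifolds. [folklore] -/
theorem not_forall_existsUnique_isDolbeaultHarmonic_mk_eq :
    ¬ ∀ (M : Type) [TopologicalSpace M] [ChartedSpace (ℂ × ℂ) M] [IsManifold 𝓘(ℝ, ℂ × ℂ) ∞ M]
        (g : ContMDiffRiemannianMetric 𝓘(ℝ, ℂ × ℂ) ∞ (ℂ × ℂ) (fun x : M ↦ TangentSpace 𝓘(ℝ, ℂ × ℂ) x))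
        (o : (x : M) → Orientation ℝ (TangentSpace 𝓘(ℝ, ℂ × ℂ) x) (Fin 4)),
        existsUnique_isDolbeaultHarmonic_mk_eq (m := 0) g o :=
  fun H ↦ TorusSwapAtlas.not_existsUnique_isDolbeaultHarmonic_mk_eq_torus4
    (H TorusSwapAtlas.T4 TorusSwapAtlas.metric4 TorusSwapAtlas.orient4)

/-- **The named fact `existsUnique_isDolbeaultHarmonic_mk_eq` is false as stated.** Closed universally
over exactly the binders it elaborates with — a finite-dimensional complex normed space `E` with
`finrank ℝ E = n`, a charted space `M` over `E` that is a *real* `C^∞` manifold (no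
`[IsManifold 𝓘(ℂ, E) ω M]`: the section instance is not mentioned in the body of the `def` and was
therefore not abstracted), the codegree `m`, a `C^∞` Riemannian metric `g` and an orientation family
`o` — the statement fails: witness `E = ℂ × ℂ`, `n = 4`, `m = 0`, the compact Hausdorff torus
`(ℝ/ℤ)⁴` with the `{id, (z, w) ↦ (z, w̄)}`-rigged real-analytic atlas `TorusSwapAtlas.chartedSpace4`,
the flat (Hermitian) metric and the orientation family `TorusSwapAtlas.orient4`, bidegree `(2,2)`
(`TorusSwapAtlas.not_existsUnique_isDolbeaultHarmonic_mk_eq_torus4`). Hence no closed proof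
`existsUnique_isDolbeaultHarmonic_mk_eq_holds` can exist. The intended statement — Voisin (2002),
Thm. 5.24; Huybrechts (2005), Cor. 3.2.9 — carries the complex-manifold hypothesis; at a complex
manifold the predicate `existsUnique_isDolbeaultHarmonic_mk_eq g o` is reduced to Warner's Theorems
6.5/6.6 for `Δ_∂̄` (`existsUnique_isDolbeaultHarmonic_mk_eq_of_regularity_of_compactness`,
`KaehlerHodgeEllipticRepresentativeProofs.lean`). [folklore] -/
theorem not_existsUnique_isDolbeaultHarmonic_mk_eq :
    ¬ ∀ {E : Type} [NormedAddCommGroup E] [NormedSpace ℂ E] {M : Type} [TopologicalSpace M]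
        [ChartedSpace E M] {m : ℕ} [FiniteDimensional ℂ E] {n : ℕ} [Fact (finrank ℝ E = n)]
        [IsManifold 𝓘(ℝ, E) ∞ M]
        (g : ContMDiffRiemannianMetric 𝓘(ℝ, E) ∞ E (fun x : M ↦ TangentSpace 𝓘(ℝ, E) x))
        (o : (x : M) → Orientation ℝ (TangentSpace 𝓘(ℝ, E) x) (Fin n)),
        existsUnique_isDolbeaultHarmonic_mk_eq (m := m) g o :=
  fun H ↦ not_forall_existsUnique_isDolbeaultHarmonic_mk_eq fun M _ _ _ g o ↦
    @H (ℂ × ℂ) _ _ M _ _ 0 _ 4 OriginSwapAtlas.fact_finrank _ g o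

end UniversalClosure

end Literature.NumberTheory.Transcendental
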